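import Literature.Probability.RandomPlanarGeometry.SAWBridgePatternRatio
import HarnessLib

/-!
# The pattern-swap engine (Madras–Slade Theorem 7.3.2) for a family closed only from a threshold on

Topic `Literature/Probability/RandomPlanarGeometry` (continues `SAWBridgePatternRatio.lean`: the generic engine
`Zd.thm732W_of_bounds` for a swap-closed family `W_N` with the closure, positivity and pattern hypotheses for ALL `N`).

Source: N. Madras, G. Slade, *The Self-Avoiding Walk* (1993), Theorem 7.3.2 (proof, pp. 244–247, 2013 reprint):
the double counting (7.3.6)–(7.3.8) and the assembly (7.3.4) are carried out AT A FIXED LARGE `N` (levels `N`,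
`N+2`, `N+4` only).  This file records that reading: the engine's conclusion holds when the family is closed under the
`(U,Q) ↔ (V,Q)` swap, nonempty, and pattern-rich only for `n ≥ n₀` — the form needed for families such as
`{ω ∈ S_N : ω(N) = x}` spliced with `S_N` below the parity/length threshold `‖x‖₁` (Theorem 7.3.2(c) for a general
site `x`), where closure fails across the threshold.  All statements are level-local copies of the tree lemmas;
nothing new mathematically.

## Contents (namespace `Literature.Probability.RandomPlanarGeometry.SAW.Zd`; 0 sorries)

* `sum_uPairsW_eq_sum_vPairsW_at`, `sum_ratio_eq_cardW_at`, `sum_ratio₂_leW_at` — (7.3.6)/(7.3.7) with closure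
  hypotheses at the single level `n`;
* **`thm732W_of_bounds_eventually`** — (7.3.4) for a family closed / nonempty / pattern-rich for `n ≥ n₀`.
-/

noncomputable section

open Filter Topology Finset Literature.Probability.LatticeModels Literature.Probability.Percolation SimpleGraph
open scoped BigOperators

namespace Literature.Probability.RandomPlanarGeometry.SAW.Zd

variable {d : ℕ}

section CountingAt

open scoped Classical

variable {W : ℕ → Finset (ℕ → Site (d + 2))} {n k : ℕ} {ω : ℕ → Site (d + 2)}

/-- **"Counting the number of allowed pairs in two ways", level-local form**: closure hypotheses at level `n`
only. [cite: MadrasSlade1993, Theorem 7.3.2 (proof), eq. (7.3.6)] -/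
theorem sum_uPairsW_eq_sum_vPairsW_at
    (hins : ∀ {k : ℕ} {ω : ℕ → Site (d + 2)}, ω ∈ W n → OccU n ω k → insV k ω ∈ W (n + 2))
    (hdel : ∀ {k : ℕ} {ω : ℕ → Site (d + 2)}, ω ∈ W (n + 2) → OccV (n + 2) ω k → delV k ω ∈ W n)
    (F G : (ℕ → Site (d + 2)) × ℕ → ℝ)
    (h : ∀ p ∈ ((W n ×ˢ Finset.range (n + 1)).filter fun p => OccU n p.1 p.2), F p = G (insV p.2 p.1, p.2)) :
    ∑ p ∈ ((W n ×ˢ Finset.range (n + 1)).filter fun p => OccU n p.1 p.2), F p =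
      ∑ q ∈ ((W (n + 2) ×ˢ Finset.range (n + 2 + 1)).filter fun p => OccV (n + 2) p.1 p.2), G q := by
  refine Finset.sum_nbij' (fun p => (insV p.2 p.1, p.2)) (fun q => (delV q.2 q.1, q.2)) ?_ ?_ ?_ ?_ h
  · intro p hp
    obtain ⟨hω, hk⟩ := mem_uPairsW.1 hp
    exact mem_vPairsW.2 ⟨hins hω hk, occV_insV hk⟩
  · intro q hq
    obtain ⟨hω, hk⟩ := mem_vPairsW.1 hq
    exact mem_uPairsW.2 ⟨hdel hω hk, occU_delV hk⟩
  · intro p hp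
    obtain ⟨-, hk⟩ := mem_uPairsW.1 hp
    simp only [delV_insV hk]
  · intro q hq
    obtain ⟨-, hk⟩ := mem_vPairsW.1 hq
    simp only [insV_delV hk]

/-- **(7.3.6), level-local form.** [cite: MadrasSlade1993, Theorem 7.3.2 (proof), eq. (7.3.6)] -/
theorem sum_ratio_eq_cardW_at (n : ℕ)
    (hins : ∀ {k : ℕ} {ω : ℕ → Site (d + 2)}, ω ∈ W n → OccU n ω k → insV k ω ∈ W (n + 2))
    (hdel : ∀ {k : ℕ} {ω : ℕ → Site (d + 2)}, ω ∈ W (n + 2) → OccV (n + 2) ω k → delV k ω ∈ W n) :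
    ∑ ω ∈ W n, (uCount n ω : ℝ) / (vCount n ω + 1) =
      (((W (n + 2)).filter fun ω => 1 ≤ vCount (n + 2) ω).card : ℝ) := by
  have h1 : ∑ ω ∈ W n, (uCount n ω : ℝ) / (vCount n ω + 1) =
      ∑ p ∈ ((W n ×ˢ Finset.range (n + 1)).filter fun p => OccU n p.1 p.2), 1 / ((vCount n p.1 : ℝ) + 1) := by
    rw [sum_uPairsW (F := fun ω => 1 / ((vCount n ω : ℝ) + 1))]
    refine Finset.sum_congr rfl fun ω _ => ?_
    rw [mul_one_div]
  have h2 : ∑ p ∈ ((W n ×ˢ Finset.range (n + 1)).filter fun p => OccU n p.1 p.2), 1 / ((vCount n p.1 : ℝ) + 1) =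
      ∑ q ∈ ((W (n + 2) ×ˢ Finset.range (n + 2 + 1)).filter fun p => OccV (n + 2) p.1 p.2), 1 / (vCount (n + 2) q.1 : ℝ) := by
    refine sum_uPairsW_eq_sum_vPairsW_at hins hdel _ (fun q => 1 / (vCount (n + 2) q.1 : ℝ)) fun p hp => ?_
    obtain ⟨-, hk⟩ := mem_uPairsW.1 hp
    simp only [vCount_insV hk, Nat.cast_succ]
  have h3 : ∑ q ∈ ((W (n + 2) ×ˢ Finset.range (n + 2 + 1)).filter fun p => OccV (n + 2) p.1 p.2), 1 / (vCount (n + 2) q.1 : ℝ) =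
      ∑ ω ∈ W (n + 2), (vCount (n + 2) ω : ℝ) * (1 / (vCount (n + 2) ω : ℝ)) :=
    sum_vPairsW (n := n + 2) (F := fun ω => 1 / (vCount (n + 2) ω : ℝ))
  rw [h1, h2, h3, Finset.card_eq_sum_ones, Nat.cast_sum, Finset.sum_filter]
  refine Finset.sum_congr rfl fun ω _ => ?_
  by_cases h : 1 ≤ vCount (n + 2) ω
  · rw [if_pos h, mul_one_div_cancel]
    · simp
    · exact_mod_cast (show vCount (n + 2) ω ≠ 0 by omega)
  · rw [if_neg h, show vCount (n + 2) ω = 0 by omega]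
    simp

/-- **(7.3.7), weak form, level-local.** [cite: MadrasSlade1993, Theorem 7.3.2 (proof), eq. (7.3.7)] -/
theorem sum_ratio₂_leW_at (n : ℕ)
    (hins : ∀ {k : ℕ} {ω : ℕ → Site (d + 2)}, ω ∈ W n → OccU n ω k → insV k ω ∈ W (n + 2))
    (hdel : ∀ {k : ℕ} {ω : ℕ → Site (d + 2)}, ω ∈ W (n + 2) → OccV (n + 2) ω k → delV k ω ∈ W n) :
    ∑ ω ∈ W n,
        (uCount n ω : ℝ) * ((uCount n ω : ℝ) - 1) / (((vCount n ω : ℝ) + 1) * ((vCount n ω : ℝ) + 2)) ≤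
      ∑ ω ∈ W (n + 2), (uCount (n + 2) ω : ℝ) / (vCount (n + 2) ω + 1) := by
  have h1 : ∑ ω ∈ W n,
      (uCount n ω : ℝ) * ((uCount n ω : ℝ) - 1) / (((vCount n ω : ℝ) + 1) * ((vCount n ω : ℝ) + 2)) =
      ∑ p ∈ ((W n ×ˢ Finset.range (n + 1)).filter fun p => OccU n p.1 p.2),
        ((uCount n p.1 : ℝ) - 1) / (((vCount n p.1 : ℝ) + 1) * ((vCount n p.1 : ℝ) + 2)) := by
    rw [sum_uPairsW (F := fun ω =>
      ((uCount n ω : ℝ) - 1) / (((vCount n ω : ℝ) + 1) * ((vCount n ω : ℝ) + 2)))]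
    refine Finset.sum_congr rfl fun ω _ => ?_
    rw [mul_div_assoc]
  have h2 : ∑ p ∈ ((W n ×ˢ Finset.range (n + 1)).filter fun p => OccU n p.1 p.2),
        ((uCount n p.1 : ℝ) - 1) / (((vCount n p.1 : ℝ) + 1) * ((vCount n p.1 : ℝ) + 2)) =
      ∑ q ∈ ((W (n + 2) ×ˢ Finset.range (n + 2 + 1)).filter fun p => OccV (n + 2) p.1 p.2),
        (uCount (n + 2) q.1 : ℝ) / ((vCount (n + 2) q.1 : ℝ) * ((vCount (n + 2) q.1 : ℝ) + 1)) := by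
    refine sum_uPairsW_eq_sum_vPairsW_at hins hdel _
      (fun q => (uCount (n + 2) q.1 : ℝ) / ((vCount (n + 2) q.1 : ℝ) * ((vCount (n + 2) q.1 : ℝ) + 1)))
      fun p hp => ?_
    obtain ⟨-, hk⟩ := mem_uPairsW.1 hp
    have hu : (uCount n p.1 : ℝ) - 1 = uCount (n + 2) (insV p.2 p.1) := by
      rw [← uCount_insV hk]; push_cast; ring
    simp only [hu, vCount_insV hk, Nat.cast_succ]
    ring_nf
  have h3 : ∑ q ∈ ((W (n + 2) ×ˢ Finset.range (n + 2 + 1)).filter fun p => OccV (n + 2) p.1 p.2),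
        (uCount (n + 2) q.1 : ℝ) / ((vCount (n + 2) q.1 : ℝ) * ((vCount (n + 2) q.1 : ℝ) + 1)) =
      ∑ ω ∈ W (n + 2), (vCount (n + 2) ω : ℝ) *
        ((uCount (n + 2) ω : ℝ) / ((vCount (n + 2) ω : ℝ) * ((vCount (n + 2) ω : ℝ) + 1))) :=
    sum_vPairsW (n := n + 2) (F := fun ω =>
      (uCount (n + 2) ω : ℝ) / ((vCount (n + 2) ω : ℝ) * ((vCount (n + 2) ω : ℝ) + 1)))
  rw [h1, h2, h3]
  refine Finset.sum_le_sum fun ω _ => ?_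
  by_cases h : vCount (n + 2) ω = 0
  · rw [h]; simp
  · have hpos : (0 : ℝ) < vCount (n + 2) ω := by exact_mod_cast Nat.pos_of_ne_zero h
    rw [le_div_iff₀ (by positivity)]
    field_simp
    exact le_rfl


end CountingAt

section Theorem732At

variable {W : ℕ → Finset (ℕ → Site (d + 2))}

/-- **(7.3.4) for a family swap-closed, nonempty and pattern-rich from a threshold `n₀` on.**
[cite: MadrasSlade1993, Theorem 7.3.2 (book p. 244, 2013 reprint) and its proof, eqs. (7.3.4)–(7.3.8)] -/
theorem thm732W_of_bounds_eventually (n₀ : ℕ)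
    (hins : ∀ {n k : ℕ} {ω : ℕ → Site (d + 2)}, n₀ ≤ n → ω ∈ W n → OccU n ω k → insV k ω ∈ W (n + 2))
    (hdel : ∀ {n k : ℕ} {ω : ℕ → Site (d + 2)}, n₀ ≤ n → ω ∈ W (n + 2) → OccV (n + 2) ω k → delV k ω ∈ W n)
    (hpos : ∀ n, n₀ ≤ n → 0 < (W n).card) {a C C' : ℝ}
    (ha : 0 < a)
    (hPT : ∀ n : ℕ, n₀ ≤ n → 1 ≤ n →
      ((((W n).filter fun ω => (vCount n ω : ℝ) < a * n).card : ℝ)) ≤ C * (W n).card / (n : ℝ) ^ 3)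
    (hS : ∀ᶠ N : ℕ in atTop,
      3 * ((W (N + 2)).card : ℝ) * (((W (N + 2)).filter fun ω => ¬ 1 ≤ vCount (N + 2) ω).card : ℝ) /
        ((W N).card : ℝ) ^ 2 ≤ C' / N) :
    ∀ᶠ N : ℕ in atTop,
      (((W (N + 2)).card : ℝ) / (W N).card) ^ 2 - (4 / a ^ 3 + 2 / a ^ 2 + 10 * C + C') / N ≤
        (((W (N + 2)).card : ℝ) / (W N).card) * (((W (N + 4)).card : ℝ) / (W (N + 2)).card) := by
  classical
  have hcpos : ∀ m, n₀ ≤ m → (0 : ℝ) < (W m).card := fun m hm => by exact_mod_cast hpos m hm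
  obtain ⟨K, hK⟩ : ∃ K : ℝ, K = 4 / a ^ 3 + 2 / a ^ 2 := ⟨_, rfl⟩
  filter_upwards [eventually_ge_atTop 1, eventually_ge_atTop n₀, hS] with N hN hNn₀ hSN
  have hN0 : (0 : ℝ) < N := by exact_mod_cast hN
  have hinsN : ∀ {k : ℕ} {ω : ℕ → Site (d + 2)}, ω ∈ W N → OccU N ω k → insV k ω ∈ W (N + 2) :=
    fun hω hk => hins hNn₀ hω hk
  have hdelN : ∀ {k : ℕ} {ω : ℕ → Site (d + 2)}, ω ∈ W (N + 2) → OccV (N + 2) ω k → delV k ω ∈ W N :=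
    fun hω hk => hdel hNn₀ hω hk
  have hinsN2 : ∀ {k : ℕ} {ω : ℕ → Site (d + 2)}, ω ∈ W (N + 2) → OccU (N + 2) ω k → insV k ω ∈ W (N + 2 + 2) :=
    fun hω hk => hins (by omega) hω hk
  have hdelN2 : ∀ {k : ℕ} {ω : ℕ → Site (d + 2)}, ω ∈ W (N + 2 + 2) → OccV (N + 2 + 2) ω k → delV k ω ∈ W (N + 2) :=
    fun hω hk => hdel (by omega) hω hk
  obtain ⟨cN, hcN_def⟩ : ∃ x : ℝ, x = (W N).card := ⟨_, rfl⟩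
  obtain ⟨cN2, hcN2_def⟩ : ∃ x : ℝ, x = (W (N + 2)).card := ⟨_, rfl⟩
  obtain ⟨cN4, hcN4_def⟩ : ∃ x : ℝ, x = (W (N + 4)).card := ⟨_, rfl⟩
  have hcN : 0 < cN := hcN_def ▸ hcpos N hNn₀
  have hcN2 : 0 < cN2 := hcN2_def ▸ hcpos (N + 2) (by omega)
  obtain ⟨A, hA⟩ : ∃ x : ℝ, x = ∑ ω ∈ W N, (uCount N ω : ℝ) / (vCount N ω + 1) := ⟨_, rfl⟩
  obtain ⟨Cq, hCq⟩ : ∃ x : ℝ,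
      x = ∑ ω ∈ W N, ((uCount N ω : ℝ) / ((vCount N ω : ℝ) + 1)) ^ 2 := ⟨_, rfl⟩
  obtain ⟨B, hB⟩ : ∃ x : ℝ, x = ∑ ω ∈ W N,
      (uCount N ω : ℝ) * ((uCount N ω : ℝ) - 1) / (((vCount N ω : ℝ) + 1) * ((vCount N ω : ℝ) + 2)) :=
    ⟨_, rfl⟩
  obtain ⟨W₁, hW₁⟩ : ∃ x : ℕ, x = ((W (N + 2)).filter fun ω => 1 ≤ vCount (N + 2) ω).card :=
    ⟨_, rfl⟩
  obtain ⟨Z, hZ⟩ : ∃ x : ℕ, x = ((W (N + 2)).filter fun ω => ¬ 1 ≤ vCount (N + 2) ω).card :=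
    ⟨_, rfl⟩
  -- (a) `A = w_{N+2}(≥ 0, ≥ 1)` (7.3.6)
  have ha' : A = W₁ := by rw [hA, hW₁]; exact sum_ratio_eq_cardW_at N hinsN hdelN
  -- (b) `|W_{N+2}| = w_{N+2}(≥0,≥1) + #{J = 0}`
  have hb : cN2 = W₁ + Z := by
    have h := Finset.card_filter_add_card_filter_not (s := W (N + 2)) (fun ω => 1 ≤ vCount (N + 2) ω)
    rw [hcN2_def, ← h, Nat.cast_add, hW₁, hZ]
  -- (c) `B ≤ |W_{N+4}|` (7.3.7)
  have hc : B ≤ cN4 := by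
    rw [hB, hcN4_def]
    refine (sum_ratio₂_leW_at N hinsN hdelN).trans ?_
    rw [sum_ratio_eq_cardW_at (N + 2) hinsN2 hdelN2]
    exact_mod_cast Finset.card_filter_le _ _
  -- (d) Schwarz (7.3.8): `A² ≤ |W_N| · Σ (I/(J+1))²`
  have hd : A ^ 2 ≤ cN * Cq := by
    have h := sq_sum_le_card_mul_sum_sq (s := W N)
      (f := fun ω => (uCount N ω : ℝ) / ((vCount N ω : ℝ) + 1))
    rw [hA, hcN_def, hCq]
    exact h
  -- (e) the term `Ξ_N`
  have he : Cq - B ≤ cN * ((K + 10 * C) / N) := by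
    rw [hCq, hB, hcN_def, hK]
    exact sum_xi_leW ha hN (hPT N hNn₀ hN)
  -- (f) the term `S_N`: `3 c_{N+2} Z / c_N² ≤ C'/N`
  have hf : 3 * cN2 * Z / cN ^ 2 ≤ C' / N := by rw [hcN2_def, hZ, hcN_def]; exact hSN
  ---- assembling
  have hφ : (((W (N + 2)).card : ℝ) / (W N).card) * (((W (N + 4)).card : ℝ) / (W (N + 2)).card) =
      cN4 / cN := by
    rw [← hcN_def, ← hcN2_def, ← hcN4_def]
    field_simp
  rw [hφ, ← hcN_def, ← hcN2_def]
  have hZ0 : (0 : ℝ) ≤ Z := Nat.cast_nonneg _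
  have hA_le : A ≤ cN2 := by rw [ha', hb]; linarith
  have h1 : cN2 ^ 2 ≤ cN * Cq + 3 * cN2 * Z := by
    have e : cN2 = A + Z := by rw [hb, ha']
    calc cN2 ^ 2 = A ^ 2 + (2 * A + Z) * Z := by rw [e]; ring
      _ ≤ cN * Cq + (2 * cN2 + cN2) * Z := by
          have : (2 * A + Z) * Z ≤ (2 * cN2 + cN2) * Z :=
            mul_le_mul_of_nonneg_right (by linarith) hZ0
          linarith
      _ = cN * Cq + 3 * cN2 * Z := by ring
  have h2 : (cN2 / cN) ^ 2 ≤ Cq / cN + 3 * cN2 * Z / cN ^ 2 := by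
    have e : Cq / cN + 3 * cN2 * Z / cN ^ 2 = (cN * Cq + 3 * cN2 * Z) / cN ^ 2 := by
      field_simp
    rw [e, div_pow]
    exact div_le_div_of_nonneg_right h1 (by positivity)
  have h3 : B / cN ≤ cN4 / cN := div_le_div_of_nonneg_right hc hcN.le
  have h4 : Cq / cN - B / cN ≤ (K + 10 * C) / N := by
    rw [← sub_div, div_le_iff₀ hcN]
    linarith
  have h6 : (K + 10 * C + C') / (N : ℝ) = (K + 10 * C) / N + C' / N := by ring
  rw [hK] at h4 h6
  rw [h6]
  linarith

end Theorem732At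

end Literature.Probability.RandomPlanarGeometry.SAW.Zd
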